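import Summits.Ventures.Crystal3D.Bulk.CapBoxSproc
import HarnessLib

/-!
# Tensor-Bernstein branch and bound: the S-procedure box rule in INTEGER arithmetic (dyadic multiplier)

Venture `Crystal3D` (cell `pub-crystal3d`, phase 2; seat typer-bulk). `CapBoxSproc.lean` accepts a box when every
coefficient of `(Y - θ) - σ·(H - η)` is `≥ 0`, with `σ` the exact rational minimum of `(y - θ)/(h - η)` over the
entries with `h > η`; that costs one normalised rational operation per tensor entry and node (measured: ≈ 0.3 s per
node on a `33³` tensor, ten times the two de Casteljau splits). Soundness holds for ANY `σ ≥ 0`, so here the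
multiplier is a dyadic `σ = p / 2^64` with `p : ℕ` read off the data by natural-number divisions (`sigmaZ`), and the
acceptance test is the equivalent natural-number comparison `θ·2^64 + p·h ≤ y·2^64 + p·η` per entry (`accZ`) —
no rational arithmetic anywhere in the search.

* `sigmaZ`, `accZ`, `allNonneg3_sprocW_of_accZ` (the integer test implies the rational one of `CapBoxSproc` for
  `σ = p/2^64`), `le_val3N_of_accZ` (soundness of the box rule);
* `bnbZ` / `bnbZ_sound`; `checkPos3Z` / `nonneg_of_checkPos3Z` — the SAME statement as `nonneg_of_checkPos3S`
  (and `nonneg_of_checkPos3`): a `true` run proves `P ≥ 0` at every point of the box with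
  `1 + 2uvt - u² - v² - t² ≥ 0`.
Everything is structurally recursive (`decide +kernel` and `native_decide` can run it). HONEST FRAMING: bookkeeping
[folklore: S-procedure relaxation on Bernstein coefficients]; nothing geometric is proved here.
-/

open Finset

namespace Summit.Ventures.Crystal3D.CapCut.Bern

/-! ### The multiplier -/

/-- Line level of `sigmaZ`: fold `min ⌊(y - θ)·2^64 / (h - η)⌋` over the paired entries with `h > η`. [folklore] -/
def sigZ1 (θ η : ℕ) : T1 → T1 → ℕ → ℕ
  | y :: ys, h :: hs, acc =>
    sigZ1 θ η ys hs (bif Nat.blt η h then Nat.min acc (((y - θ) <<< 64) / (h - η)) else acc)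
  | _, _, acc => acc

/-- Slice level of `sigmaZ`. [folklore] -/
def sigZ2 (θ η : ℕ) : T2 → T2 → ℕ → ℕ
  | ln :: sl, hn :: hl, acc => sigZ2 θ η sl hl (sigZ1 θ η ln hn acc)
  | _, _, acc => acc

/-- Tensor level of `sigmaZ`. [folklore] -/
def sigZ3 (θ η : ℕ) : T3 → T3 → ℕ → ℕ
  | sl :: Y, hl :: H, acc => sigZ3 θ η Y H (sigZ2 θ η sl hl acc)
  | _, _, acc => acc

/-- The numerator `p` of the dyadic multiplier `σ = p / 2^64`: the least `⌊(y - θ)·2^64 / (h - η)⌋` over the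
entries with `h > η`, capped at `2^124`. (Soundness does not depend on this choice.) [folklore] -/
def sigmaZ (θ η : ℕ) (Y H : T3) : ℕ := sigZ3 θ η Y H (2 ^ 124)

/-! ### The integer acceptance test -/

/-- Line level of `accZ`: `A + p·h ≤ y·2^64 + c` for all paired entries (`A = θ·2^64`, `c = p·η`);
`false` on a length mismatch. [folklore] -/
def accZ1 (A p c : ℕ) : T1 → T1 → Bool
  | y :: ys, h :: hs => Nat.ble (A + p * h) ((y <<< 64) + c) && accZ1 A p c ys hs
  | [], [] => true
  | _, _ => false

/-- Slice level of `accZ`. [folklore] -/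
def accZ2 (A p c : ℕ) : T2 → T2 → Bool
  | ln :: sl, hn :: hl => accZ1 A p c ln hn && accZ2 A p c sl hl
  | [], [] => true
  | _, _ => false

/-- Tensor level of `accZ`. [folklore] -/
def accZ3 (A p c : ℕ) : T3 → T3 → Bool
  | sl :: Y, hl :: H => accZ2 A p c sl hl && accZ3 A p c Y H
  | [], [] => true
  | _, _ => false

/-- **The integer S-procedure acceptance test** with multiplier `σ = p/2^64`: every paired entry satisfies
`θ·2^64 + p·h ≤ y·2^64 + p·η`, i.e. `(y - θ) - σ (h - η) ≥ 0`. [folklore] -/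
def accZ (p θ η : ℕ) (Y H : T3) : Bool := accZ3 (θ <<< 64) p (p * η) Y H

/-! ### The integer test implies the rational one -/

section Bridge
variable (p θ η : ℕ)

/-- The entry function of `sprocW` for `σ = p/2^64`. [folklore] -/
abbrev fZ (p θ η : ℕ) (y h : ℕ) : ℚ := ((y : ℚ) - θ) - ((p : ℚ) / 2 ^ 64) * ((h : ℚ) - η)

/-- One entry: the natural-number comparison gives the rational sign. [folklore] -/
theorem fZ_nonneg_of_ble (y h : ℕ) (hle : Nat.ble ((θ <<< 64) + p * h) ((y <<< 64) + p * η) = true) :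
    0 ≤ fZ p θ η y h := by
  rw [Nat.ble_eq, Nat.shiftLeft_eq, Nat.shiftLeft_eq] at hle
  have hle' : (θ : ℚ) * 2 ^ 64 + p * h ≤ (y : ℚ) * 2 ^ 64 + p * η := by exact_mod_cast hle
  have h2 : (0 : ℚ) < 2 ^ 64 := by positivity
  have e : ((p : ℚ) / 2 ^ 64) * ((h : ℚ) - η) = ((p : ℚ) * h - p * η) / 2 ^ 64 := by ring
  unfold fZ
  rw [e, sub_nonneg, div_le_iff₀ h2]
  linarith

/-- Line level. [folklore] -/
theorem accZ1_sound : ∀ (ln hn : T1), accZ1 (θ <<< 64) p (p * η) ln hn = true →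
    ∀ q ∈ List.zipWith (fZ p θ η) ln hn, 0 ≤ q := by
  intro ln
  induction ln with
  | nil => intro hn _ q hq; cases hn <;> simp at hq
  | cons y ys ih =>
    intro hn h q hq
    cases hn with
    | nil => simp at hq
    | cons x hs =>
      simp only [accZ1, Bool.and_eq_true] at h
      rw [List.zipWith_cons_cons, List.mem_cons] at hq
      rcases hq with rfl | hq
      · exact fZ_nonneg_of_ble p θ η y x h.1
      · exact ih hs h.2 q hq

/-- Slice level. [folklore] -/
theorem accZ2_sound : ∀ (sl hl : T2), accZ2 (θ <<< 64) p (p * η) sl hl = true →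
    ∀ ln ∈ List.zipWith (fun a b => List.zipWith (fZ p θ η) a b) sl hl, ∀ q ∈ ln, 0 ≤ q := by
  intro sl
  induction sl with
  | nil => intro hl _ ln hln; cases hl <;> simp at hln
  | cons a as ih =>
    intro hl h ln hln
    cases hl with
    | nil => simp at hln
    | cons b bs =>
      simp only [accZ2, Bool.and_eq_true] at h
      rw [List.zipWith_cons_cons, List.mem_cons] at hln
      rcases hln with rfl | hln
      · exact accZ1_sound p θ η a b h.1
      · exact ih bs h.2 ln hln

/-- Tensor level: `accZ` implies that every entry of `sprocW (p/2^64) θ η Y H` is `≥ 0`. [folklore] -/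
theorem accZ3_sound : ∀ (Y H : T3), accZ3 (θ <<< 64) p (p * η) Y H = true →
    ∀ sl ∈ sprocW ((p : ℚ) / 2 ^ 64) θ η Y H, ∀ ln ∈ sl, ∀ q ∈ ln, 0 ≤ q := by
  intro Y
  induction Y with
  | nil => intro H _ sl hsl; cases H <;> simp [sprocW] at hsl
  | cons a as ih =>
    intro H h sl hsl
    cases H with
    | nil => simp [sprocW] at hsl
    | cons b bs =>
      simp only [accZ3, Bool.and_eq_true] at h
      have e : sprocW ((p : ℚ) / 2 ^ 64) θ η (a :: as) (b :: bs) =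
          List.zipWith (fun x y => List.zipWith (fZ p θ η) x y) a b :: sprocW ((p : ℚ) / 2 ^ 64) θ η as bs := rfl
      rw [e, List.mem_cons] at hsl
      rcases hsl with rfl | hsl
      · exact accZ2_sound p θ η a b h.1
      · exact ih bs h.2 sl hsl

/-- **Bridge**: the integer test implies the rational one of `CapBoxSproc.lean` for `σ = p/2^64`. [folklore] -/
theorem allNonneg3_sprocW_of_accZ (Y H : T3) (h : accZ p θ η Y H = true) :
    allNonneg3 (sprocW ((p : ℚ) / 2 ^ 64) θ η Y H) = true := by
  simp only [allNonneg3, List.all_eq_true, decide_eq_true_eq]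
  intro sl hsl ln hln q hq
  exact accZ3_sound p θ η Y H h sl hsl ln hln q hq

end Bridge

/-- **Soundness of the integer S-procedure box rule**: if accepted, wherever the `H`-value is `≥ η` on the
cube, the `Y`-value is `≥ θ` (any `p`). [folklore] -/
theorem le_val3N_of_accZ (n θ η p : ℕ) (Y H : T3) (hY : Shape3 n Y) (hH : Shape3 n H)
    (h : accZ p θ η Y H = true) {s1 s2 s3 : ℝ} (h10 : 0 ≤ s1) (h11 : s1 ≤ 1) (h20 : 0 ≤ s2) (h21 : s2 ≤ 1)
    (h30 : 0 ≤ s3) (h31 : s3 ≤ 1) (hval : (η : ℝ) ≤ val3N n H s1 s2 s3) : (θ : ℝ) ≤ val3N n Y s1 s2 s3 := by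
  have hσ0 : (0 : ℝ) ≤ ((((p : ℚ) / 2 ^ 64 : ℚ)) : ℝ) := by
    have : (0 : ℚ) ≤ (p : ℚ) / 2 ^ 64 := by positivity
    exact_mod_cast this
  have hW := val3Q_nonneg_of_allNonneg3 n _ (shape3_sprocW n ((p : ℚ) / 2 ^ 64) θ η Y H hY hH)
    (allNonneg3_sprocW_of_accZ p θ η Y H h) h10 h11 h20 h21 h30 h31
  rw [val3Q_sprocW n ((p : ℚ) / 2 ^ 64) θ η Y H hY hH] at hW
  have : (0 : ℝ) ≤ ((((p : ℚ) / 2 ^ 64 : ℚ)) : ℝ) * (val3N n H s1 s2 s3 - η) := mul_nonneg hσ0 (by linarith)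
  linarith

/-! ### The search with the integer rule -/

/-- The branch and bound with the integer S-procedure rule (target and Gram tensors both of degree `n`).
[folklore] -/
def bnbZ (n : ℕ) : ℕ → ℕ → T3 → ℕ → T3 → ℕ → Bool
  | 0, _, _, _, _, _ => false
  | fuel + 1, ax, Y, θ, H, η =>
    allGe3 θ Y ||
      (allLt3 η H ||
        (accZ (sigmaZ θ η Y H) θ η Y H ||
          (bnbZ n fuel (nextAx ax) (splitL ax Y) (sc0 n θ) (splitL ax H) (sc0 n η) &&
            bnbZ n fuel (nextAx ax) (splitR ax Y) (sc0 n θ) (splitR ax H) (sc0 n η))))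

set_option maxHeartbeats 800000 in
/-- **Soundness of the search with the integer S-procedure rule.** [folklore] -/
theorem bnbZ_sound (n : ℕ) : ∀ (fuel ax : ℕ) (Y : T3) (θ : ℕ) (H : T3) (η : ℕ),
    bnbZ n fuel ax Y θ H η = true → Shape3 n Y → Shape3 n H →
    ∀ s1 s2 s3 : ℝ, 0 ≤ s1 → s1 ≤ 1 → 0 ≤ s2 → s2 ≤ 1 → 0 ≤ s3 → s3 ≤ 1 →
      (η : ℝ) ≤ val3N n H s1 s2 s3 → (θ : ℝ) ≤ val3N n Y s1 s2 s3 := by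
  intro fuel
  induction fuel with
  | zero => intro ax Y θ H η h; simp [bnbZ] at h
  | succ fuel ih =>
    intro ax Y θ H η h hY hH s1 s2 s3 h10 h11 h20 h21 h30 h31 hval
    simp only [bnbZ, Bool.or_eq_true, Bool.and_eq_true] at h
    rcases h with hge | hlt | hsp | ⟨hl, hr⟩
    · exact le_val3N_of_allGe3 n Y hY θ hge h10 h11 h20 h21 h30 h31
    · exact absurd hval (not_le.2 (val3N_lt_of_allLt3 n H hH η hlt h10 h11 h20 h21 h30 h31))
    · exact le_val3N_of_accZ n θ η _ Y H hY hH hsp h10 h11 h20 h21 h30 h31 hval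
    · have ihL := ih _ _ _ _ _ hl (shape3_splitL n ax Y hY) (shape3_splitL n ax H hH)
      have ihR := ih _ _ _ _ _ hr (shape3_splitR n ax Y hY) (shape3_splitR n ax H hH)
      match ax with
      | 0 =>
        exact split_step n n θ η (fun x => val3N n Y x s2 s3) (fun x => val3N n H x s2 s3)
          (fun x => val3N n (splitL 0 Y) x s2 s3) (fun x => val3N n (splitL 0 H) x s2 s3)
          (fun x => val3N n (splitR 0 Y) x s2 s3) (fun x => val3N n (splitR 0 H) x s2 s3)
          (fun x => val3N_splitL0 n Y hY x s2 s3) (fun x => val3N_splitL0 n H hH x s2 s3)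
          (fun x => val3N_splitR0 n Y hY x s2 s3) (fun x => val3N_splitR0 n H hH x s2 s3)
          (fun s' h0' h1' hv => ihL s' s2 s3 h0' h1' h20 h21 h30 h31 hv)
          (fun s' h0' h1' hv => ihR s' s2 s3 h0' h1' h20 h21 h30 h31 hv) s1 h10 h11 hval
      | 1 =>
        exact split_step n n θ η (fun x => val3N n Y s1 x s3) (fun x => val3N n H s1 x s3)
          (fun x => val3N n (splitL 1 Y) s1 x s3) (fun x => val3N n (splitL 1 H) s1 x s3)
          (fun x => val3N n (splitR 1 Y) s1 x s3) (fun x => val3N n (splitR 1 H) s1 x s3)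
          (fun x => val3N_splitL1 n Y hY s1 x s3) (fun x => val3N_splitL1 n H hH s1 x s3)
          (fun x => val3N_splitR1 n Y hY s1 x s3) (fun x => val3N_splitR1 n H hH s1 x s3)
          (fun s' h0' h1' hv => ihL s1 s' s3 h10 h11 h0' h1' h30 h31 hv)
          (fun s' h0' h1' hv => ihR s1 s' s3 h10 h11 h0' h1' h30 h31 hv) s2 h20 h21 hval
      | k + 2 =>
        exact split_step n n θ η (fun x => val3N n Y s1 s2 x) (fun x => val3N n H s1 s2 x)
          (fun x => val3N n (splitL (k + 2) Y) s1 s2 x) (fun x => val3N n (splitL (k + 2) H) s1 s2 x)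
          (fun x => val3N n (splitR (k + 2) Y) s1 s2 x) (fun x => val3N n (splitR (k + 2) H) s1 s2 x)
          (fun x => val3N_splitL2 n k Y hY s1 s2 x) (fun x => val3N_splitL2 n k H hH s1 s2 x)
          (fun x => val3N_splitR2 n k Y hY s1 s2 x) (fun x => val3N_splitR2 n k H hH s1 s2 x)
          (fun s' h0' h1' hv => ihL s1 s2 s' h10 h11 h20 h21 h0' h1' hv)
          (fun s' h0' h1' hv => ihR s1 s2 s' h10 h11 h20 h21 h0' h1' hv) s3 h30 h31 hval

/-! ### End to end -/

/-- The complete check with the integer S-procedure rule: same preparation as `checkPos3S` (power → Bernstein on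
the box, integerisation `2^NB` / `2^NGB` with offsets, Gram polynomial padded to degree `n`), then `bnbZ`. [folklore] -/
def checkPos3Z (P : QT3) (n : ℕ) (lo0 hi0 lo1 hi1 lo2 hi2 : ℚ) (NB NGB fuel : ℕ) : Bool :=
  let B := toBern3 lo0 hi0 lo1 hi1 lo2 hi2 P
  let N : ℕ := 2 ^ NB
  let M : ℕ := (-(⌊(N : ℚ) * minEntry3 B⌋)).toNat
  let G := toBern3 lo0 hi0 lo1 hi1 lo2 hi2 (pad3 n gramQ3)
  let NG : ℕ := 2 ^ NGB
  let MG : ℕ := (-(⌊(NG : ℚ) * minEntry3 G⌋)).toNat + 1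
  shapeOK3 n P && shapeOK3 n (pad3 n gramQ3) && decide (lo0 < hi0) && decide (lo1 < hi1) && decide (lo2 < hi2) &&
    offsetOK N M B && offsetOKUp NG MG G &&
      bnbZ n fuel 0 (toNat3 N M B) M (toNat3Up NG MG G) MG

/-- **Soundness of the check with the integer S-procedure rule** (same statement as `nonneg_of_checkPos3S`).
[folklore] -/
theorem nonneg_of_checkPos3Z (P : QT3) (n : ℕ) (lo0 hi0 lo1 hi1 lo2 hi2 : ℚ) (NB NGB fuel : ℕ)
    (h : checkPos3Z P n lo0 hi0 lo1 hi1 lo2 hi2 NB NGB fuel = true) :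
    ∀ u v t : ℝ, (lo0 : ℝ) ≤ u → u ≤ hi0 → (lo1 : ℝ) ≤ v → v ≤ hi1 → (lo2 : ℝ) ≤ t → t ≤ hi2 →
      0 ≤ 1 + 2 * u * v * t - u ^ 2 - v ^ 2 - t ^ 2 → 0 ≤ eval3 P u v t := by
  intro u v t hu0 hu1 hv0 hv1 ht0 ht1 hgram
  simp only [checkPos3Z, Bool.and_eq_true, decide_eq_true_eq] at h
  obtain ⟨⟨⟨⟨⟨⟨⟨hshape, hshapeG⟩, hl0⟩, hl1⟩, hl2⟩, hoff⟩, hoffG⟩, hbnb⟩ := h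
  set B := toBern3 lo0 hi0 lo1 hi1 lo2 hi2 P with hB
  set G := toBern3 lo0 hi0 lo1 hi1 lo2 hi2 (pad3 n gramQ3) with hG
  set N : ℕ := 2 ^ NB with hN
  set NG : ℕ := 2 ^ NGB with hNG
  set M : ℕ := (-(⌊(N : ℚ) * minEntry3 B⌋)).toNat with hM
  set MG : ℕ := (-(⌊(NG : ℚ) * minEntry3 G⌋)).toNat + 1 with hMG
  have hP : Shape3 n P := shape3_of_shapeOK3 n P hshape
  have hPG : Shape3 n (pad3 n gramQ3) := shape3_of_shapeOK3 n _ hshapeG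
  have hBs : Shape3 n B := shape3_toBern3 n _ _ _ _ _ _ P hP
  have hGs : Shape3 n G := shape3_toBern3 n _ _ _ _ _ _ _ hPG
  have hYs : Shape3 n (toNat3 N M B) := shape3_map3 n _ B hBs
  have hHs : Shape3 n (toNat3Up NG MG G) := shape3_map3 n _ G hGs
  have d0 : (0 : ℝ) < hi0 - lo0 := by
    have h' : ((lo0 : ℚ) : ℝ) < hi0 := by exact_mod_cast hl0
    linarith
  have d1 : (0 : ℝ) < hi1 - lo1 := by
    have h' : ((lo1 : ℚ) : ℝ) < hi1 := by exact_mod_cast hl1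
    linarith
  have d2 : (0 : ℝ) < hi2 - lo2 := by
    have h' : ((lo2 : ℚ) : ℝ) < hi2 := by exact_mod_cast hl2
    linarith
  set s1 := (u - lo0) / (hi0 - lo0) with hs1
  set s2 := (v - lo1) / (hi1 - lo1) with hs2
  set s3 := (t - lo2) / (hi2 - lo2) with hs3
  have h10 : 0 ≤ s1 := div_nonneg (by linarith) d0.le
  have h11 : s1 ≤ 1 := (div_le_one d0).2 (by linarith)
  have h20 : 0 ≤ s2 := div_nonneg (by linarith) d1.le
  have h21 : s2 ≤ 1 := (div_le_one d1).2 (by linarith)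
  have h30 : 0 ≤ s3 := div_nonneg (by linarith) d2.le
  have h31 : s3 ≤ 1 := (div_le_one d2).2 (by linarith)
  have e0 : (lo0 : ℝ) * (1 - s1) + hi0 * s1 = u := by rw [hs1]; field_simp; ring
  have e1 : (lo1 : ℝ) * (1 - s2) + hi1 * s2 = v := by rw [hs2]; field_simp; ring
  have e2 : (lo2 : ℝ) * (1 - s3) + hi2 * s3 = t := by rw [hs3]; field_simp; ring
  have hHval : (MG : ℝ) ≤ val3N n (toNat3Up NG MG G) s1 s2 s3 := by
    have hup := le_val3N_toNat3Up n G hGs NG MG hoffG h10 h11 h20 h21 h30 h31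
    rw [hG, val3Q_toBern3 n _ hPG, e0, e1, e2, eval3_pad3, eval3_gramQ3] at hup
    have : (0 : ℝ) ≤ (NG : ℝ) * (1 + 2 * u * v * t - u ^ 2 - v ^ 2 - t ^ 2) := by positivity
    linarith
  have hY := bnbZ_sound n fuel 0 _ M _ MG hbnb hYs hHs s1 s2 s3 h10 h11 h20 h21 h30 h31 hHval
  have hle := val3N_toNat3_le n B hBs N M hoff h10 h11 h20 h21 h30 h31
  rw [hB, val3Q_toBern3 n P hP, e0, e1, e2] at hle
  have hNpos : (0 : ℝ) < N := by rw [hN]; positivity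
  have hNe : (0 : ℝ) ≤ (N : ℝ) * eval3 P u v t := by linarith
  by_contra hneg
  push Not at hneg
  have : (N : ℝ) * eval3 P u v t < 0 := mul_neg_of_pos_of_neg hNpos hneg
  linarith

end Summit.Ventures.Crystal3D.CapCut.Bern
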